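import Literature.RepresentationTheory.MoeglinVignerasWaldspurger1987.RankOneThetaLiftTwistReduction
import Literature.RepresentationTheory.MoeglinVignerasWaldspurger1987.RankOneOscillatorMultiplicityOne   -- `localPi_one_mul_comm`
import Literature.RepresentationTheory.TwistedCoinvariantsTypePeriodicity                          -- `norm_coe_eq_one_of_le_ker`, `continuous_coe_of_le_ker`
import HarnessLib

/-!
# The vanishing central character of a theta lift under a change of section: `χ₀(η·s) = χ₀(s) · η_Z`

Topic `RepresentationTheory/MoeglinVignerasWaldspurger1987`; THEOREMS ONLY (no definition, no named fact, no `sorry`, no instance,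
no notation).  Cell hodgecm-mathlib, floor 0, fan B rung B-IV, seat B-p04 (g43); `--supports stmt-HodgeConjecture-24832`.

WHY.  ★ `RankOneThetaAnisotropicPlaneDichotomy(Centre)` (p849778∕p849816∕p849863) and its CM reading ★ `LemD1Item1AtV2AnisotropicDichotomy`
(p850021∕ED. 2) prove: at an anisotropic non-split place the `χ`-coinvariants of the local Weil representation `ω_s = toRep ∘ s` along
the centre vanish for EXACTLY ONE unitary continuous character `χ₀ = χ₀(s)` — unpinned.  The pin («`χ̌₀ = μ_v²`» for the CM section,
[Liu2021, Lem. D.1 (1)]) is an explicit evaluation for ONE section; A-p19 (g30)'s census (§4(a), first clause) asks for the bookkeeping that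
moves it between sections over the same `ι_v`.  Two sections `s, s′ : U(J)(F_v) →* S̃p_ψ` over `ι_v` differ by a character `η` of `U(J)(F_v)`
(★ `MpPsi.exists_character_of_proj_eq`; `ω_{s′} = η • ω_s`, ★ `MpPsi.toRep_comp_apply_of_forall_eq_ofScalar_mul`), and the relation submodules of
the coinvariants along any homomorphism `ζ : Z →* U(J)(F_v)` satisfy `ker(ω_{s′} ∘ ζ, χ·η_Z) = ker(ω_s ∘ ζ, χ)`, `η_Z = η ∘ ζ`
(★ `TwistedCoinv.ker_eq_of_forall_smul`).  Hence:

* §1 (generic, `TwistedCoinv`) `nontrivial_coinv_mul_iff_of_forall_eq_smul` — `Coinv(ρ′, χ·κ) ≠ 0 ⟺ Coinv(ρ, χ) ≠ 0` for `ρ′ = κ • ρ`;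
  `vanishingChar_mul_of_forall_eq_smul` — if `χ₀` is THE vanishing unitary continuous character of `ρ` and `κ` is unitary continuous, then
  `χ₀ · κ` is THE vanishing unitary continuous character of `ρ′`.
* §2 (sections) `nontrivial_coinv_sections_mul_iff`, `vanishingChar_sections` — the same for `ω_{s′} ∘ ζ` vs `ω_s ∘ ζ` with `κ = η ∘ ζ`.
* §3 (rank-one centre at a non-split place) `exists_character_vanishingChar_eq_mul` — for two sections `s, s′` over the same map with SMOOTH
  Weil representations and the centre embedded from a line `J′` (`J′₀₀ ≠ 0`) at a place with `E_v` a field: there is `η` with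
  `s′ = i(η) · s`, `η_Z := η ∘ localCenter` has OPEN kernel (smoothness, ★ `isOpen_ker_of_twist_of_isSmoothVector`), is unitary and continuous
  (compact centre), and **every vanishing-character statement for `s` at `χ₀` transfers to `s′` at `χ₀ · η_Z`**.

So the pin of ANY section over `ι_v` is the pin of any other times the centre restriction of their ratio — [MVW, Chap. 2 II.1 (B)] ∕
[GelbartRogawski1991, §3.1 Remark p. 457].  HC_CM is proved only modulo the printed citations — the 2 remaining named inputs (hLiu418 =
stmt-HodgeConjecture-24832, h413 = 24833) — until rung 0 closes; count-neutral.

## References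
* [MoeglinVignerasWaldspurger1987] C. Mœglin, M.-F. Vignéras, J.-L. Waldspurger, LNM 1291 (1987), Chap. 2 II.1 (B); Chap. 3 §IV.4.
* [GelbartRogawski1991] S. Gelbart, J. Rogawski, Invent. Math. 105 (1991), §3.1 Remark p. 457 L4–13.
* [BernsteinZelevinsky1976] I. N. Bernstein, A. V. Zelevinsky, Russian Math. Surveys 31 (1976), §2.1.
-/

set_option autoImplicit false

noncomputable section

/-! ## §1 Generic: the vanishing character of a scalar twist -/

namespace Literature.RepresentationTheory.TwistedCoinv

variable {Z S : Type*} [Group Z] [AddCommGroup S] [Module ℂ S]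

/-- **`Coinv(κ • ρ, χ·κ) ≠ 0 ⟺ Coinv(ρ, χ) ≠ 0`**: a pointwise scalar twist `ρ′ z = κ z • ρ z` shifts the characters with non-zero
coinvariants by `κ` (the relation submodules are EQUAL, ★ `ker_eq_of_forall_smul`). [cite: GelbartRogawski1991, §3.1 Remark p. 457 L4–13] -/
theorem nontrivial_coinv_mul_iff_of_forall_eq_smul (ρ ρ' : Representation ℂ Z S) (κ : Z →* ℂˣ)
    (h : ∀ (z : Z) (v : S), ρ' z v = ((κ z : ℂˣ) : ℂ) • ρ z v) (χ : Z →* ℂˣ) :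
    Nontrivial (Coinv ρ' (χ * κ)) ↔ Nontrivial (Coinv ρ χ) := by
  have hker : ker ρ' (χ * κ) = ker ρ χ :=
    ker_eq_of_forall_smul (fun z => κ z) h fun z => by rw [MonoidHom.mul_apply, mul_comm]
  show Nontrivial (S ⧸ ker ρ' (χ * κ)) ↔ Nontrivial (S ⧸ ker ρ χ)
  rw [hker]

/-- **THE vanishing character moves by `κ`**: if among unitary continuous characters `χ₀` is the unique one with `Coinv(ρ, χ₀) = 0`
(`hmain`) and `κ` is unitary and continuous, then `χ₀ · κ` is the unique one with `Coinv(κ • ρ, ·) = 0`.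
[cite: GelbartRogawski1991, §3.1 Remark p. 457 L4–13] [cite: MoeglinVignerasWaldspurger1987, Chap. 2 II.1 (B)] -/
theorem vanishingChar_mul_of_forall_eq_smul [TopologicalSpace Z] (ρ ρ' : Representation ℂ Z S) (κ : Z →* ℂˣ)
    (h : ∀ (z : Z) (v : S), ρ' z v = ((κ z : ℂˣ) : ℂ) • ρ z v)
    (hκu : ∀ z, ‖((κ z : ℂˣ) : ℂ)‖ = 1) (hκc : Continuous fun z => ((κ z : ℂˣ) : ℂ)) (χ₀ : Z →* ℂˣ)
    (hmain : ∀ χ : Z →* ℂˣ, (∀ z, ‖((χ z : ℂˣ) : ℂ)‖ = 1) → (Continuous fun z => ((χ z : ℂˣ) : ℂ)) →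
      (Nontrivial (Coinv ρ χ) ↔ χ ≠ χ₀))
    (χ : Z →* ℂˣ) (hχu : ∀ z, ‖((χ z : ℂˣ) : ℂ)‖ = 1) (hχc : Continuous fun z => ((χ z : ℂˣ) : ℂ)) :
    Nontrivial (Coinv ρ' χ) ↔ χ ≠ χ₀ * κ := by
  -- `χ = χ₁ · κ` with `χ₁ = χ · κ⁻¹` unitary continuous
  obtain ⟨χ₁, rfl⟩ : ∃ χ₁ : Z →* ℂˣ, χ = χ₁ * κ :=
    ⟨χ * κ⁻¹, MonoidHom.ext fun z => by rw [MonoidHom.mul_apply, MonoidHom.mul_apply, MonoidHom.inv_apply, inv_mul_cancel_right]⟩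
  have hχ₁u : ∀ z, ‖((χ₁ z : ℂˣ) : ℂ)‖ = 1 := fun z => by
    have h1 := hχu z
    rw [MonoidHom.mul_apply, Units.val_mul, norm_mul, hκu z, mul_one] at h1
    exact h1
  have hχ₁c : Continuous fun z => ((χ₁ z : ℂˣ) : ℂ) := by
    have hne : ∀ z, ((κ z : ℂˣ) : ℂ) ≠ 0 := fun z => (κ z).ne_zero
    have heq : (fun z => ((χ₁ z : ℂˣ) : ℂ)) = fun z => (((χ₁ * κ) z : ℂˣ) : ℂ) * (((κ z : ℂˣ) : ℂ))⁻¹ := by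
      funext z
      rw [MonoidHom.mul_apply, Units.val_mul, mul_assoc, mul_inv_cancel₀ (hne z), mul_one]
    rw [heq]
    exact hχc.mul (hκc.inv₀ hne)
  rw [nontrivial_coinv_mul_iff_of_forall_eq_smul ρ ρ' κ h χ₁, hmain χ₁ hχ₁u hχ₁c]
  exact (mul_left_injective κ).ne_iff.symm

end Literature.RepresentationTheory.TwistedCoinv

/-! ## §2 Two sections into MVW's group of pairs -/

namespace Literature.RepresentationTheory.MoeglinVignerasWaldspurger1987

open NumberField IsDedekindDomain
open scoped Matrix
open Literature.RepresentationTheory.HeisenbergGroup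
open Literature.RepresentationTheory.TwistedCoinv (Coinv)
open Literature.NumberTheory.GelbartRogawski1991.UnitaryDualPair.LocalSplitting
open Literature.NumberTheory.Automorphic
open Literature.NumberTheory.Automorphic.UnitaryGroup

section Sections

variable {R : Type*} [CommRing R] [Invertible (2 : R)] {V : Type*} [AddCommGroup V] [Module R V] {B : V →ₗ[R] V →ₗ[R] R}
  {S : Type*} [AddCommGroup S] [Module ℂ S] (ρ : Representation ℂ (Heisenberg B) S)
  {G Z : Type*} [Group G] [Group Z] (s s' : G →* MpPsi ρ) (η : G →* ℂˣ)
  (hη : ∀ g, s' g = MpPsi.ofScalar ρ (η g) * s g) (ζ : Z →* G)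

include hη in
/-- the twist relation along `ζ`, in the syntactic shape of §1: `(ω_{s′} ∘ ζ)(z) f = (η∘ζ)(z) • (ω_s ∘ ζ)(z) f`.
[cite: MoeglinVignerasWaldspurger1987, Chap. 2 II.1 (B)] -/
theorem toRep_comp_comp_apply_eq_smul (z : Z) (f : S) :
    (((MpPsi.toRep ρ).comp s').comp ζ) z f = (((η.comp ζ) z : ℂˣ) : ℂ) • (((MpPsi.toRep ρ).comp s).comp ζ) z f :=
  MpPsi.toRep_comp_apply_of_forall_eq_ofScalar_mul ρ s s' η hη (ζ z) f

include hη in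
/-- **`Coinv(ω_{s′} ∘ ζ, χ·(η∘ζ)) ≠ 0 ⟺ Coinv(ω_s ∘ ζ, χ) ≠ 0`** for two sections `s′ = i(η)·s` into `S̃p_ψ` and any homomorphism `ζ` into
the group (e.g. the local centre). [cite: MoeglinVignerasWaldspurger1987, Chap. 2 II.1 (B)] [cite: GelbartRogawski1991, §3.1 Remark p. 457 L4–13] -/
theorem nontrivial_coinv_sections_mul_iff (χ : Z →* ℂˣ) :
    Nontrivial (Coinv (((MpPsi.toRep ρ).comp s').comp ζ) (χ * η.comp ζ)) ↔ Nontrivial (Coinv (((MpPsi.toRep ρ).comp s).comp ζ) χ) :=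
  TwistedCoinv.nontrivial_coinv_mul_iff_of_forall_eq_smul (((MpPsi.toRep ρ).comp s).comp ζ) (((MpPsi.toRep ρ).comp s').comp ζ)
    (η.comp ζ) (toRep_comp_comp_apply_eq_smul ρ s s' η hη ζ) χ

include hη in
/-- **the vanishing character along `ζ` moves by `η ∘ ζ`** when the section is changed from `s` to `s′ = i(η)·s` (`η ∘ ζ` unitary continuous).
[cite: MoeglinVignerasWaldspurger1987, Chap. 2 II.1 (B)] [cite: GelbartRogawski1991, §3.1 Remark p. 457 L4–13] -/
theorem vanishingChar_sections [TopologicalSpace Z]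
    (hηu : ∀ z, ‖((η (ζ z) : ℂˣ) : ℂ)‖ = 1) (hηc : Continuous fun z => ((η (ζ z) : ℂˣ) : ℂ)) (χ₀ : Z →* ℂˣ)
    (hmain : ∀ χ : Z →* ℂˣ, (∀ z, ‖((χ z : ℂˣ) : ℂ)‖ = 1) → (Continuous fun z => ((χ z : ℂˣ) : ℂ)) →
      (Nontrivial (Coinv (((MpPsi.toRep ρ).comp s).comp ζ) χ) ↔ χ ≠ χ₀))
    (χ : Z →* ℂˣ) (hχu : ∀ z, ‖((χ z : ℂˣ) : ℂ)‖ = 1) (hχc : Continuous fun z => ((χ z : ℂˣ) : ℂ)) :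
    Nontrivial (Coinv (((MpPsi.toRep ρ).comp s').comp ζ) χ) ↔ χ ≠ χ₀ * η.comp ζ :=
  TwistedCoinv.vanishingChar_mul_of_forall_eq_smul (((MpPsi.toRep ρ).comp s).comp ζ) (((MpPsi.toRep ρ).comp s').comp ζ) (η.comp ζ)
    (toRep_comp_comp_apply_eq_smul ρ s s' η hη ζ) hηu hηc χ₀ hmain χ hχu hχc

end Sections

/-! ## §3 The rank-one centre at a non-split place: the ratio of two smooth sections has open kernel on the centre -/

section Centre

variable (F : Type) [Field F] [NumberField F] (E : Type) [Field E] [NumberField E] [Algebra F E]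
  [Algebra.IsQuadraticExtension F E] (c : E ≃ₐ[F] E) {δ : E} (hcδ : c δ = -δ) (hδ : δ ≠ 0)
  (v : HeightOneSpectrum (𝓞 F)) {N : ℕ} {T : Matrix (Fin N) (Fin N) F} (hTd : IsUnit T.det)
  {J : Matrix (Fin N) (Fin N) E} {J' : Matrix (Fin 1) (Fin 1) E} (hJ'0 : J' 0 0 ≠ 0) (hE : IsField (UnitaryGroup.LocalRing E v))
  (s s' : UnitaryGroup.localPi E c N J v →* LocalMp F N T v)
  (hss' : ∀ g, MpPsi.proj _ (s' g) = MpPsi.proj _ (s g))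
  (hsm : Representation.IsSmooth ((MpPsi.toRep (localSchrodinger F N T v)).comp s))
  (hsm' : Representation.IsSmooth ((MpPsi.toRep (localSchrodinger F N T v)).comp s'))

include hcδ hδ hTd hE hss' hsm hsm' in
-- the metaplectic section terms: 2× the default budget (as ★ `RankOneThetaLiftTwistReduction`)
set_option maxHeartbeats 400000 in
/-- **Change of section for the vanishing central character (rank-one centre, non-split place).**  For two sections `s, s′` of `U(J)(F_v)` into
`S̃p_ψ(𝕎_v)` over the same map with SMOOTH Weil representations, and the centre embedded from a line `J′` (`J′₀₀ ≠ 0`) at a place with `E_v` a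
field: there is a character `η` of `U(J)(F_v)` with `s′ = i(η)·s` whose centre restriction `η_Z = η ∘ localCenter` has OPEN kernel and is unitary
and continuous, and for every `χ₀`: if `χ₀` is THE unitary continuous character killing `Coinv(ω_s ∘ centre, ·)` then `χ₀ · η_Z` is the one for
`s′`.  (The torsor ★ `MpPsi.exists_character_of_proj_eq`; open kernel by smoothness ★ `isOpen_ker_of_twist_of_isSmoothVector`; the centre
`U(J′)(F_v) = E_v¹` is compact.) [cite: MoeglinVignerasWaldspurger1987, Chap. 2 II.1 (B); Chap. 3 §IV.4] [cite: GelbartRogawski1991, §3.1 Remark p. 457 L4–13]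
[cite: BernsteinZelevinsky1976, §2.1] -/
theorem exists_character_vanishingChar_eq_mul :
    ∃ η : UnitaryGroup.localPi E c N J v →* ℂˣ,
      (∀ g, s' g = MpPsi.ofScalar _ (η g) * s g) ∧
      IsOpen ((η.comp (UnitaryGroup.localCenter E c N J J' hJ'0 v)).ker : Set (UnitaryGroup.localPi E c 1 J' v)) ∧
      (∀ z, ‖((η (UnitaryGroup.localCenter E c N J J' hJ'0 v z) : ℂˣ) : ℂ)‖ = 1) ∧
      (Continuous fun z => ((η (UnitaryGroup.localCenter E c N J J' hJ'0 v z) : ℂˣ) : ℂ)) ∧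
      ∀ χ₀ : UnitaryGroup.localPi E c 1 J' v →* ℂˣ,
        (∀ χ : UnitaryGroup.localPi E c 1 J' v →* ℂˣ, (∀ z, ‖((χ z : ℂˣ) : ℂ)‖ = 1) → (Continuous fun z => ((χ z : ℂˣ) : ℂ)) →
          (Nontrivial (Coinv (((MpPsi.toRep (localSchrodinger F N T v)).comp s).comp (UnitaryGroup.localCenter E c N J J' hJ'0 v)) χ) ↔
            χ ≠ χ₀)) →
        ∀ χ : UnitaryGroup.localPi E c 1 J' v →* ℂˣ, (∀ z, ‖((χ z : ℂˣ) : ℂ)‖ = 1) → (Continuous fun z => ((χ z : ℂˣ) : ℂ)) →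
          (Nontrivial (Coinv (((MpPsi.toRep (localSchrodinger F N T v)).comp s').comp (UnitaryGroup.localCenter E c N J J' hJ'0 v)) χ) ↔
            χ ≠ χ₀ * η.comp (UnitaryGroup.localCenter E c N J J' hJ'0 v)) := by
  classical
  haveI : Nontrivial (SchwartzBruhat (Fin N → v.adicCompletion F)) := nontrivial_schwartzBruhat_pi
  /- the non-split place: `c ≠ 1`, a place `w` fixed by `c`, compact centre -/
  have hc1 : c ≠ 1 := by
    rintro rfl
    exact hδ (self_eq_neg.1 (by simpa only [AlgEquiv.one_apply] using hcδ))
  obtain ⟨w⟩ := (inferInstance : Nonempty (PlacesOver E v))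
  have hw : c • w.1 = w.1 := by
    by_contra hw
    exact Liu2021.LemD1IndexedNonVacuityAtPlace.not_isField_localRing_of_split E v c w hw hE
  haveI : CompactSpace (UnitaryGroup.localPi E c 1 J' v) := compactSpace_localPi_one_of_smul_eq c J' hc1 hJ'0 w hw
  /- the two sections differ by a character `η` with open kernel -/
  obtain ⟨η, hη⟩ := MpPsi.exists_character_of_proj_eq (localSchrodinger F N T v)
    (implementerUniqueUpToScalar_localSchrodinger F N T hTd v) s s' hss'
  have hωη : ∀ (g : UnitaryGroup.localPi E c N J v) (f : SchwartzBruhat (Fin N → v.adicCompletion F)),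
      ((MpPsi.toRep (localSchrodinger F N T v)).comp s') g f = ((η g : ℂˣ) : ℂ) • ((MpPsi.toRep (localSchrodinger F N T v)).comp s) g f :=
    MpPsi.toRep_comp_apply_of_forall_eq_ofScalar_mul (localSchrodinger F N T v) s s' η hη
  obtain ⟨Φ₀, hΦ₀⟩ := exists_ne (0 : SchwartzBruhat (Fin N → v.adicCompletion F))
  have hηo : IsOpen ((η.ker : Subgroup (UnitaryGroup.localPi E c N J v)) : Set (UnitaryGroup.localPi E c N J v)) :=
    isOpen_ker_of_twist_of_isSmoothVector ((MpPsi.toRep (localSchrodinger F N T v)).comp s)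
      ((MpPsi.toRep (localSchrodinger F N T v)).comp s') η hωη hΦ₀ (hsm Φ₀) (hsm' Φ₀)
  -- the centre restriction `η_Z`
  have hηZo : IsOpen ((η.comp (UnitaryGroup.localCenter E c N J J' hJ'0 v)).ker : Set (UnitaryGroup.localPi E c 1 J' v)) := by
    have : ((η.comp (UnitaryGroup.localCenter E c N J J' hJ'0 v)).ker : Set (UnitaryGroup.localPi E c 1 J' v)) =
        UnitaryGroup.localCenter E c N J J' hJ'0 v ⁻¹' (η.ker : Set (UnitaryGroup.localPi E c N J v)) := by
      ext z; simp only [SetLike.mem_coe, MonoidHom.mem_ker, MonoidHom.comp_apply, Set.mem_preimage]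
    rw [this]
    exact hηo.preimage (UnitaryGroup.continuous_localCenter E c N J J' hJ'0 v)
  -- unitary and continuous: a character of the compact centre with open kernel
  haveI : (η.comp (UnitaryGroup.localCenter E c N J J' hJ'0 v)).ker.Normal :=
    ⟨fun n hn g => by rwa [localPi_one_mul_comm E c J' v g n, mul_inv_cancel_right]⟩
  haveI : Finite (UnitaryGroup.localPi E c 1 J' v ⧸ (η.comp (UnitaryGroup.localCenter E c N J J' hJ'0 v)).ker) :=
    Subgroup.quotient_finite_of_isOpen _ hηZo
  have hηu : ∀ z, ‖((η (UnitaryGroup.localCenter E c N J J' hJ'0 v z) : ℂˣ) : ℂ)‖ = 1 := fun z =>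
    TwistedCoinv.norm_coe_eq_one_of_le_ker (η.comp (UnitaryGroup.localCenter E c N J J' hJ'0 v)) _ le_rfl z
  have hηc : Continuous fun z => ((η (UnitaryGroup.localCenter E c N J J' hJ'0 v z) : ℂˣ) : ℂ) :=
    TwistedCoinv.continuous_coe_of_le_ker (η.comp (UnitaryGroup.localCenter E c N J J' hJ'0 v)) _ hηZo le_rfl
  exact ⟨η, hη, hηZo, hηu, hηc, fun χ₀ hmain χ hχu hχc =>
    vanishingChar_sections (localSchrodinger F N T v) s s' η hη (UnitaryGroup.localCenter E c N J J' hJ'0 v) hηu hηc χ₀ hmain χ hχu hχc⟩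

end Centre

end Literature.RepresentationTheory.MoeglinVignerasWaldspurger1987

end
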